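import Literature.Analysis.FluidPDE.ESSFarFieldVorticityHalfSpaceTopCurlFrame
import Literature.Analysis.FluidPDE.LocalLerayBackwardUniquenessAnyDatum
import Literature.Analysis.FluidPDE.NSLocalLerayFarFieldTrace
import Literature.Analysis.FluidPDE.LocalTypeIProofs
import Mathlib.Analysis.SpecialFunctions.SmoothTransition
import HarnessLib

/-!
# Backward uniqueness for local Leray solutions on a slab from an IRROTATIONAL half-space of the
# final value (Lemarié-Rieusset 2016, Thm. 15.4, vorticity form)

Analysis/FluidPDE proof file (theorems only: no definition, no named fact, no `sorry`).

The only consumer of the final value in the tree's Thm. 15.4 route is Escauriaza–Seregin–Šverák's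
far-field backward uniqueness for the VORTICITY equation (Thm. 5.1, datum `ω(·, T₁) = 0` on a
half-space); its vorticity-level far-field step is `farField_curl_eq_zero_halfSpace_of_vorticity_top_of_frame`.
* `localLeray_farField_curl_eq_zero_slab_of_halfSpace_irrotational` — if the final value of a slab
  local Leray solution `u` is IRROTATIONAL on `{x₃ > R₁}` in the weak sense (`∫⟪u(t), ∇ ∧ ψ⟫ → 0`
  as `t ↑ T₁` for the test fields `ψ` supported there), a representative of `u` has vanishing
  vorticity on `(T₄, T₁) × {x₃ > R}`: the far-field representative `U` (`exists_farField_representative`),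
  the cut-off vorticity `σ(x₃) ∇ ∧ U`, whose pairings are `∫⟪U(t), ∇ ∧ (σφ)⟫` (the curl is
  self-adjoint) `= ∫⟪u(t), ∇ ∧ (σφ)⟫` for a.e. `t`, continuous in `t`, hence `→ 0` as `t ↑ T₁`.
* `IsLocalLeraySolutionOn.ae_zero_of_halfSpace_final_irrotational_unit` — **Thm. 15.4 from an
  irrotational half-space of the final value** (unit viscosity): such a solution vanishes a.e.
  (verbatim the tree's assembly: CKN regular times, bounded strips, `ae_zero_strip_of_farField_curl_eq_zero`).
In words: the final value of a nontrivial local Leray solution has nonzero vorticity in every half-space.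

## References

* P. G. Lemarié-Rieusset, *The Navier–Stokes Problem in the 21st Century* (2016), Thm. 15.4.
* L. Escauriaza, G. Seregin, V. Šverák, Russ. Math. Surveys 58:2 (2003), §3, Thm. 5.1, §5.
* G. Seregin, Comm. Math. Phys. 312 (2012) 833–845, §4.
-/

noncomputable section

open MeasureTheory TopologicalSpace Set Function Filter Metric
open _root_.Topology
open scoped ENNReal NNReal InnerProductSpace RealInnerProductSpace ContDiff

namespace Literature.Analysis.FluidPDE

/-! ### The direction `e₃` and a smooth step across the plane `{x₃ = R}` -/

/-- The third coordinate vector `e₃` is a unit vector with `⟪x, e₃⟫ = x₃`. [folklore] -/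
private theorem e3_norm_and_inner :
    ‖(EuclideanSpace.basisFun (Fin 3) ℝ 2 : EuclideanSpace ℝ (Fin 3))‖ = 1 ∧
      ∀ x : EuclideanSpace ℝ (Fin 3), ⟪x, EuclideanSpace.basisFun (Fin 3) ℝ 2⟫ = x 2 := by
  refine ⟨(EuclideanSpace.basisFun (Fin 3) ℝ).orthonormal.1 2, fun x => ?_⟩
  rw [EuclideanSpace.basisFun_apply, EuclideanSpace.inner_single_right]
  simp

/-- **A smooth step across the plane `{⟪x, e⟫ = R}`**: `σ(x) = smoothTransition (2 (⟪x, e⟫ − R) + 1)`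
is `C^∞`, equal to `1` on `{⟪x, e⟫ ≥ R}` and to `0` on `{⟪x, e⟫ ≤ R − 1/2}`; for a test field `φ`,
`σ • φ` is a test field. [folklore] -/
private theorem halfSpace_cutoff (e : EuclideanSpace ℝ (Fin 3)) (R : ℝ) :
    ∃ σ : EuclideanSpace ℝ (Fin 3) → ℝ, (∀ x : EuclideanSpace ℝ (Fin 3), R ≤ ⟪x, e⟫ → σ x = 1) ∧
      (∀ x : EuclideanSpace ℝ (Fin 3), σ x ≠ 0 → R - 1 / 2 < ⟪x, e⟫) ∧
      ∀ φ : EuclideanSpace ℝ (Fin 3) → EuclideanSpace ℝ (Fin 3),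
        FunctionSpaces.IsTestFunctionOn (⊤ : Opens (EuclideanSpace ℝ (Fin 3))) φ →
        FunctionSpaces.IsTestFunctionOn (⊤ : Opens (EuclideanSpace ℝ (Fin 3))) (fun x => σ x • φ x) := by
  have h1 : ContDiff ℝ ∞ (fun x : EuclideanSpace ℝ (Fin 3) => 2 * (⟪x, e⟫ - R) + 1) :=
    (contDiff_const.mul ((contDiff_id.inner ℝ contDiff_const).sub contDiff_const)).add
      contDiff_const
  refine ⟨fun x => Real.smoothTransition (2 * (⟪x, e⟫ - R) + 1), ?_, ?_, ?_⟩
  · intro x hx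
    exact Real.smoothTransition.one_of_one_le (by linarith)
  · intro x hx
    by_contra hle
    push Not at hle
    exact hx (Real.smoothTransition.zero_of_nonpos (by linarith))
  · intro φ hφ
    exact ⟨(Real.smoothTransition.contDiff.comp h1).smul hφ.contDiff,
      hφ.hasCompactSupport.mono fun x hx => right_ne_zero_of_smul hx, fun y _ => Opens.mem_top y⟩

/-- **A function continuous on `(a, b)` which agrees a.e. with a function tending to `0` at `b⁻`
tends to `0` at `b⁻`** (the exceptional null set cannot contain an interval). [folklore] -/
private theorem tendsto_zero_of_continuousOn_of_ae_eq {a b : ℝ} (hab : a < b) {f g : ℝ → ℝ}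
    (hg : ContinuousOn g (Ioo a b)) (hfg : ∀ᵐ t ∂(volume.restrict (Ioo a b)), g t = f t)
    (hf : Tendsto f (𝓝[<] b) (𝓝 0)) : Tendsto g (𝓝[<] b) (𝓝 0) := by
  rw [Metric.tendsto_nhdsWithin_nhds] at hf ⊢
  intro ε hε
  obtain ⟨δ₁, hδ₁, hfε⟩ := hf (ε / 2) (half_pos hε)
  refine ⟨min δ₁ (b - a), lt_min hδ₁ (sub_pos.2 hab), fun t ht hdist => ?_⟩
  have htb : t < b := ht
  rw [Real.dist_eq, abs_sub_comm, abs_of_pos (sub_pos.2 htb)] at hdist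
  have hta : a < t := by
    have := min_le_right δ₁ (b - a); linarith
  have htI : t ∈ Ioo a b := ⟨hta, htb⟩
  rw [Real.dist_eq, sub_zero]
  by_contra hcon
  push Not at hcon
  have hgt : ContinuousAt g t := hg.continuousAt (Ioo_mem_nhds hta htb)
  have hev : ∀ᶠ s in 𝓝 t, ε / 2 < |g s| := by
    have h1 : ∀ᶠ s in 𝓝 t, dist (g s) (g t) < ε / 2 := (Metric.tendsto_nhds.1 hgt) (ε / 2) (half_pos hε)
    filter_upwards [h1] with s hs
    rw [Real.dist_eq] at hs
    have := abs_sub_abs_le_abs_sub (g t) (g s)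
    rw [abs_sub_comm] at this
    linarith
  have hev2 : ∀ᶠ s in 𝓝 t, s ∈ Ioo a b ∧ dist s b < δ₁ := by
    have h1 : ∀ᶠ s in 𝓝 t, s ∈ Ioo a b := Ioo_mem_nhds hta htb
    have h2 : ∀ᶠ s in 𝓝 t, dist s b < δ₁ := by
      have hd : dist t b < δ₁ := by
        rw [Real.dist_eq, abs_sub_comm, abs_of_pos (sub_pos.2 htb)]
        exact lt_of_lt_of_le hdist (min_le_left _ _)
      have hc : Tendsto (fun s : ℝ => dist s b) (𝓝 t) (𝓝 (dist t b)) :=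
        (continuous_id.dist continuous_const).continuousAt
      exact hc.eventually (gt_mem_nhds hd)
    exact h1.and h2
  obtain ⟨η, hη, hball⟩ := Metric.eventually_nhds_iff.1 (hev.and hev2)
  set J : Set ℝ := Ioo (t - η / 2) (t + η / 2) with hJ
  have hJsub : J ⊆ Ioo a b := fun s hs => (hball (by
    rw [Real.dist_eq, abs_lt]; constructor <;> linarith [hs.1, hs.2])).2.1
  have hJpos : volume J ≠ 0 := by
    rw [hJ, Real.volume_Ioo, Ne, ENNReal.ofReal_eq_zero, not_le]
    linarith
  have haeJ : ∀ᵐ s ∂(volume.restrict J), g s = f s ∧ s ∈ J :=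
    (ae_restrict_of_ae_restrict_of_subset hJsub hfg).and (ae_restrict_mem measurableSet_Ioo)
  haveI : (ae (volume.restrict J)).NeBot := ae_neBot.2 (by rwa [Ne, Measure.restrict_eq_zero])
  obtain ⟨s₀, hs₀eq, hs₀J⟩ := haeJ.exists
  obtain ⟨h1, h2, h3⟩ := hball (show dist s₀ t < η by
    rw [Real.dist_eq, abs_lt]; constructor <;> linarith [hs₀J.1, hs₀J.2])
  have hfs : dist (f s₀) 0 < ε / 2 := hfε h2.2 h3
  rw [Real.dist_eq, sub_zero, ← hs₀eq] at hfs
  linarith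

/-! ### Steps 2–3 of the proof of Thm. 15.4 on a slab, final value irrotational on a half-space -/

/-- **The far-field vorticity of a slab local Leray solution whose final value is IRROTATIONAL on
`{x₃ > R₁}` (pairings with the curls of the test fields supported there tend to `0` as `t ↑ T₁`)
vanishes on `(T₄, T₁) × {x₃ > R}` for a representative `U`, `C¹` in space** (Lemarié-Rieusset 2016,
proof of Thm. 15.4, Steps 2–3; Escauriaza–Seregin–Šverák 2003, §3 with Thm. 5.1, datum `ω(·,T₁) = 0`). [cite: LemarieRieusset2016, proof of Thm. 15.4, Steps 2–3 (PDF pp. 568–569)] [cite: EscauriazaSereginSverak2003, §3 (3.31)–(3.32) and Thm. 5.1] -/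
theorem localLeray_farField_curl_eq_zero_slab_of_halfSpace_irrotational
    (hB : NSBoundedHigherRegularityBounds) {ν T₁ : ℝ} (hν : 0 < ν)
    {u₀ : EuclideanSpace ℝ (Fin 3) → EuclideanSpace ℝ (Fin 3)}
    {u : ℝ → EuclideanSpace ℝ (Fin 3) → EuclideanSpace ℝ (Fin 3)}
    {p : ℝ → EuclideanSpace ℝ (Fin 3) → ℝ}
    (hdiv : IsWeaklyDivFree u₀) (hu : IsLocalLeraySolutionOn T₁ ν u₀ u p) {R₁ : ℝ}
    (hirr : ∀ ψ : EuclideanSpace ℝ (Fin 3) → EuclideanSpace ℝ (Fin 3),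
      FunctionSpaces.IsTestFunctionOn (⊤ : Opens (EuclideanSpace ℝ (Fin 3))) ψ →
        (∀ x, ψ x ≠ 0 → R₁ < x 2) →
        Tendsto (fun t => ∫ x, ⟪u t x, curl ψ x⟫) (𝓝[<] T₁) (𝓝 0))
    {T₄ : ℝ} (hT₄ : T₄ ∈ Ioo 0 T₁) :
    ∃ (R : ℝ) (U : ℝ → EuclideanSpace ℝ (Fin 3) → EuclideanSpace ℝ (Fin 3)),
      (∀ t ∈ Ioo T₄ T₁, ContDiffOn ℝ 1 (U t) {x : EuclideanSpace ℝ (Fin 3) | R < x 2}) ∧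
        uncurry U =ᵐ[volume.restrict
          (Ioo T₄ T₁ ×ˢ {x : EuclideanSpace ℝ (Fin 3) | R < x 2})] uncurry u ∧
        ∀ t ∈ Ioo T₄ T₁, ∀ x : EuclideanSpace ℝ (Fin 3), R < x 2 → curl (U t) x = 0 := by
  obtain ⟨he, hinner⟩ := e3_norm_and_inner
  set e : EuclideanSpace ℝ (Fin 3) := EuclideanSpace.basisFun (Fin 3) ℝ 2 with hedef
  have ht₁ : (0 : ℝ) < T₄ / 2 := by linarith [hT₄.1]
  obtain ⟨R₀, hbd⟩ := hu.farField_bound_anyDatum hν ht₁ (le_refl T₁)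
  set R : ℝ := max (max R₀ R₁) 0 + 2 with hRdef
  have hR₀R : R₀ < R - 1 := by
    rw [hRdef]; linarith [le_max_left R₀ R₁, le_max_left (max R₀ R₁) 0]
  have hR₁R : R₁ + 1 ≤ R := by
    rw [hRdef]; linarith [le_max_right R₀ R₁, le_max_left (max R₀ R₁) 0]
  have hR1 : (1 : ℝ) ≤ R := by rw [hRdef]; linarith [le_max_right (max R₀ R₁) 0]
  obtain ⟨K, U, hae, hUc, hCD, hjc, hbdK⟩ := exists_farField_representative hB
    kangMiuraTsai_local_pressure_bound_holds hν hdiv hu ht₁ le_rfl hbd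
    (by linarith [hT₄.1] : T₄ / 2 < T₄) hT₄.2 hR₀R 3
  set S : Set (EuclideanSpace ℝ (Fin 3)) := (closedBall (0 : EuclideanSpace ℝ (Fin 3)) (R - 1))ᶜ
    with hSdef
  have hSo : IsOpen S := isClosed_closedBall.isOpen_compl
  set H : Set (EuclideanSpace ℝ (Fin 3)) := {x : EuclideanSpace ℝ (Fin 3) | R < ⟪x, e⟫} with hHdef
  have hHo : IsOpen H := isOpen_lt continuous_const (continuous_id.inner continuous_const)
  have hcoord : ∀ x : EuclideanSpace ℝ (Fin 3), x 2 ≤ ‖x‖ := fun x => by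
    have h := PiLp.norm_apply_le x (2 : Fin 3)
    rw [Real.norm_eq_abs] at h
    exact (le_abs_self _).trans h
  have hlayer : ∀ x : EuclideanSpace ℝ (Fin 3), R - 1 / 2 ≤ ⟪x, e⟫ → x ∈ S := fun x hx => by
    rw [hinner] at hx
    rw [hSdef, mem_compl_iff, mem_closedBall, dist_zero_right, not_le]
    linarith [hcoord x]
  have hHS : H ⊆ S := fun x hx => by
    have hx' : R < ⟪x, e⟫ := hx
    exact hlayer x (by linarith)
  set Ω : Set (ℝ × EuclideanSpace ℝ (Fin 3)) := Ioo T₄ T₁ ×ˢ H with hΩdef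
  have hΩo : IsOpen Ω := isOpen_Ioo.prod hHo
  have hΩsub : Ω ⊆ Ioo T₄ T₁ ×ˢ S := prod_mono Subset.rfl hHS
  have hle : (⟨Ω, hΩo⟩ : Opens (ℝ × EuclideanSpace ℝ (Fin 3))) ≤
      slab (EuclideanSpace ℝ (Fin 3)) (Ioo 0 T₁) isOpen_Ioo := fun w hw =>
    mem_slab.2 ⟨hT₄.1.trans hw.1.1, hw.1.2⟩
  have haeΩ : uncurry U =ᵐ[volume.restrict Ω] uncurry u :=
    ae_restrict_of_ae_restrict_of_subset hΩsub hae
  have hsolU : IsDistributionalNSSolutionOn ⟨Ω, hΩo⟩ ν 0 U p :=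
    (hu.distributional.of_le hle).congr_ae haeΩ.symm (ae_of_all _ fun _ => rfl)
  obtain ⟨σ, hσ1, hσsupp, hσtest⟩ := halfSpace_cutoff e R
  set ω' : ℝ → EuclideanSpace ℝ (Fin 3) → EuclideanSpace ℝ (Fin 3) :=
    fun t x => σ x • curl (U t) x with hω'def
  have hae' : uncurry (vorticity U) =ᵐ[volume.restrict Ω] uncurry ω' := by
    refine (ae_restrict_mem hΩo.measurableSet).mono fun z hz => ?_
    show vorticity U z.1 z.2 = σ z.2 • curl (U z.1) z.2
    rw [vorticity_apply, hσ1 z.2 (le_of_lt hz.2), one_smul]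
  have hfinal' : ∀ φ : EuclideanSpace ℝ (Fin 3) → EuclideanSpace ℝ (Fin 3),
      FunctionSpaces.IsTestFunctionOn (⊤ : Opens (EuclideanSpace ℝ (Fin 3))) φ →
        Tendsto (fun t => ∫ x, ⟪ω' t x, φ x⟫) (𝓝[<] T₁) (𝓝 0) := by
    intro φ hφ
    set Ψ : EuclideanSpace ℝ (Fin 3) → EuclideanSpace ℝ (Fin 3) := fun x => σ x • φ x with hΨdef
    have hΨ : FunctionSpaces.IsTestFunctionOn (⊤ : Opens (EuclideanSpace ℝ (Fin 3))) Ψ := hσtest φ hφ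
    have hΨfar : ∀ x, Ψ x ≠ 0 → R₁ < x 2 := fun x hx => by
      have h := hσsupp x (left_ne_zero_of_smul hx)
      rw [hinner] at h
      linarith
    have hΨS : tsupport Ψ ⊆ S := by
      intro x hx
      have hsub : Function.support Ψ ⊆ {y : EuclideanSpace ℝ (Fin 3) | R - 1 / 2 ≤ ⟪y, e⟫} :=
        fun y hy => (hσsupp y (left_ne_zero_of_smul hy)).le
      have hcl : IsClosed {y : EuclideanSpace ℝ (Fin 3) | R - 1 / 2 ≤ ⟪y, e⟫} :=
        isClosed_le continuous_const (continuous_id.inner continuous_const)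
      exact hlayer x (closure_minimal hsub hcl hx)
    have hΨ1 : ContDiff ℝ ((⊤ : ℕ∞) + 1) Ψ := by simpa using hΨ.contDiff
    have hcΨ : ContDiff ℝ (⊤ : ℕ∞) (curl Ψ) := contDiff_curl hΨ1
    have hcΨS : ∀ x ∉ tsupport Ψ, curl Ψ x = 0 := fun x hx => curl_eq_zero_of_notMem_tsupport hx
    have hident : ∀ t ∈ Ioo T₄ T₁, ∫ x, ⟪ω' t x, φ x⟫ = ∫ x, ⟪U t x, curl Ψ x⟫ := by
      intro t ht
      have h1 : (fun x => ⟪ω' t x, φ x⟫) = fun x => ⟪curl (U t) x, Ψ x⟫ := by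
        funext x
        show ⟪σ x • curl (U t) x, φ x⟫ = ⟪curl (U t) x, σ x • φ x⟫
        rw [real_inner_smul_left, real_inner_smul_right]
      rw [h1]
      have hU1 : ContDiffOn ℝ 1 (U t) S := fun x hx =>
        ((hCD (t, x) ⟨ht, hx⟩).of_le (by norm_cast)).contDiffWithinAt
      exact integral_inner_curl_eq_of_contDiffOn hSo hU1 (hΨ.contDiff.of_le (by norm_cast))
        hΨ.hasCompactSupport hΨS
    have hg : ContinuousOn (fun t => ∫ x, ⟪U t x, curl Ψ x⟫) (Ioo T₄ T₁) := by
      refine continuousOn_integral_of_support_subset (μ := volume) (K := tsupport Ψ)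
        hΨ.hasCompactSupport ?_ ?_
      · rintro ⟨t, x⟩ ⟨ht, -⟩
        by_cases hx : x ∈ tsupport Ψ
        · have hUa : ContinuousAt (uncurry U) (t, x) :=
            (hUc (t, x) ⟨ht, hΨS hx⟩).continuousAt ((isOpen_Ioo.prod hSo).mem_nhds ⟨ht, hΨS hx⟩)
          have hca : ContinuousAt (fun z : ℝ × EuclideanSpace ℝ (Fin 3) => ⟪U z.1 z.2, curl Ψ z.2⟫)
              (t, x) := hUa.inner (hcΨ.continuous.continuousAt.comp continuousAt_snd)
          exact hca.continuousWithinAt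
        · have hev : ∀ᶠ z in 𝓝 ((t, x) : ℝ × EuclideanSpace ℝ (Fin 3)),
              (fun z : ℝ × EuclideanSpace ℝ (Fin 3) => ⟪U z.1 z.2, curl Ψ z.2⟫) z = 0 := by
            have h1 : ∀ᶠ y in 𝓝 x, y ∉ tsupport Ψ :=
              (isClosed_tsupport Ψ).isOpen_compl.mem_nhds hx
            have hsnd : Tendsto (fun z : ℝ × EuclideanSpace ℝ (Fin 3) => z.2)
                (𝓝 ((t, x) : ℝ × EuclideanSpace ℝ (Fin 3))) (𝓝 x) := continuousAt_snd
            have h2 := hsnd.eventually h1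
            filter_upwards [h2] with z hz
            show ⟪U z.1 z.2, curl Ψ z.2⟫ = 0
            rw [hcΨS z.2 hz, inner_zero_right]
          exact ((continuousAt_const (y := (0 : ℝ))).congr
            (hev.mono fun z hz => hz.symm)).continuousWithinAt
      · intro t _ x hx
        show ⟪U t x, curl Ψ x⟫ = 0
        rw [hcΨS x hx, inner_zero_right]
    have haeS : uncurry U =ᵐ[volume.restrict (Ioo T₄ T₁ ×ˢ S)] uncurry u := hae
    have haet : ∀ᵐ t ∂(volume.restrict (Ioo T₄ T₁)),
        (∫ x, ⟪U t x, curl Ψ x⟫) = ∫ x, ⟪u t x, curl Ψ x⟫ := by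
      have h := SuitableCompactness.ae_ae_of_ae_prod_restrict
        (P := fun z => uncurry U z = uncurry u z) haeS
      filter_upwards [h] with t ht
      refine integral_congr_ae ?_
      have h1 : ∀ᵐ x ∂volume, x ∈ S → U t x = u t x := (ae_restrict_iff' hSo.measurableSet).1 ht
      filter_upwards [h1] with x hx
      by_cases hxS : x ∈ S
      · show ⟪U t x, curl Ψ x⟫ = ⟪u t x, curl Ψ x⟫
        rw [hx hxS]
      · show ⟪U t x, curl Ψ x⟫ = ⟪u t x, curl Ψ x⟫
        rw [hcΨS x (fun h' => hxS (hΨS h')), inner_zero_right, inner_zero_right]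
    have hlimU : Tendsto (fun t => ∫ x, ⟪U t x, curl Ψ x⟫) (𝓝[<] T₁) (𝓝 0) :=
      tendsto_zero_of_continuousOn_of_ae_eq hT₄.2 hg haet (hirr Ψ hΨ hΨfar)
    refine hlimU.congr' ?_
    have hev : ∀ᶠ t in 𝓝[<] T₁, t ∈ Ioo T₄ T₁ := by
      have : Ioo T₄ T₁ ∈ 𝓝[<] T₁ := Ioo_mem_nhdsLT hT₄.2
      exact this
    filter_upwards [hev] with t ht
    exact (hident t ht).symm
  have hzero : ∀ t ∈ Ioo T₄ T₁, ∀ x : EuclideanSpace ℝ (Fin 3),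
      R + Real.sqrt (ν * (T₁ - T₄)) < ⟪x, e⟫ → curl (U t) x = 0 :=
    farField_curl_eq_zero_halfSpace_of_vorticity_top_of_frame he hν hT₄.2 hfinal' hae' hsolU
      (fun w hw => hCD w (hΩsub hw)) (fun n _ => (hjc n).mono hΩsub)
      (fun n hn w hw => hbdK n hn w (hΩsub hw))
  have hγ : 0 ≤ Real.sqrt (ν * (T₁ - T₄)) := Real.sqrt_nonneg _
  have hHof : ∀ x : EuclideanSpace ℝ (Fin 3), R + Real.sqrt (ν * (T₁ - T₄)) < x 2 → x ∈ H :=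
    fun x hx => by
      show R < ⟪x, e⟫
      rw [hinner]
      linarith
  refine ⟨R + Real.sqrt (ν * (T₁ - T₄)), U, fun t ht => ?_, ?_, fun t ht x hx => ?_⟩
  · have hUS : ContDiffOn ℝ 1 (U t) S := fun x hx =>
      ((hCD (t, x) ⟨ht, hx⟩).of_le (by exact_mod_cast le_top)).contDiffWithinAt
    exact hUS.mono fun x hx => hHS (hHof x hx)
  · exact ae_restrict_of_ae_restrict_of_subset
      (prod_mono Subset.rfl fun x hx => hHS (hHof x hx)) hae
  · exact hzero t ht x (by rw [hinner]; exact hx)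

/-! ### Thm. 15.4 on a slab from an irrotational half-space of the final value -/

/-- **Backward uniqueness for slab local Leray solutions from an IRROTATIONAL HALF-SPACE of the
final value, unit viscosity** (Lemarié-Rieusset 2016, Thm. 15.4, through Escauriaza–Seregin–Šverák
2003, Thm. 5.1 / §5): a local Leray solution on `(0, T) × ℝ³` with weakly divergence-free datum whose
pairings with the curls of the test fields supported in `{x₃ > R₁}` tend to `0` as `t ↑ T` vanishes a.e.
[cite: LemarieRieusset2016, Thm. 15.4 (PDF p. 568)] [cite: EscauriazaSereginSverak2003, §5] [cite: Seregin2012CMP, §4] -/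
theorem IsLocalLeraySolutionOn.ae_zero_of_halfSpace_final_irrotational_unit {T : ℝ} (hT : 0 < T)
    {u₀ : EuclideanSpace ℝ (Fin 3) → EuclideanSpace ℝ (Fin 3)}
    {v : ℝ → EuclideanSpace ℝ (Fin 3) → EuclideanSpace ℝ (Fin 3)}
    {π : ℝ → EuclideanSpace ℝ (Fin 3) → ℝ}
    (hdiv : IsWeaklyDivFree u₀) (hv : IsLocalLeraySolutionOn T 1 u₀ v π) {R₁ : ℝ}
    (hirr : ∀ ψ : EuclideanSpace ℝ (Fin 3) → EuclideanSpace ℝ (Fin 3),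
      FunctionSpaces.IsTestFunctionOn (⊤ : Opens (EuclideanSpace ℝ (Fin 3))) ψ →
        (∀ x, ψ x ≠ 0 → R₁ < x 2) →
        Tendsto (fun t => ∫ x, ⟪v t x, curl ψ x⟫) (𝓝[<] T) (𝓝 0)) :
    ∀ᵐ z ∂(volume.restrict (Ioo 0 T ×ˢ (univ : Set (EuclideanSpace ℝ (Fin 3))))),
      v z.1 z.2 = 0 := by
  suffices hmain : ∀ T₄ ∈ Ioo 0 T,
      ∀ᵐ z ∂(volume.restrict (Ioo T₄ T ×ˢ (univ : Set (EuclideanSpace ℝ (Fin 3))))),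
        v z.1 z.2 = 0 by
    have hn : ∀ n : ℕ, ∀ᵐ z ∂(volume.restrict
        (Ioo (T / (n + 2)) T ×ˢ (univ : Set (EuclideanSpace ℝ (Fin 3))))), v z.1 z.2 = 0 :=
      fun n => hmain _ ⟨by positivity, div_lt_self hT (by norm_cast; omega)⟩
    have hU : Ioo 0 T ×ˢ (univ : Set (EuclideanSpace ℝ (Fin 3))) =
        ⋃ n : ℕ, Ioo (T / (n + 2)) T ×ˢ (univ : Set (EuclideanSpace ℝ (Fin 3))) := by
      ext ⟨t, x⟩
      simp only [mem_prod, mem_Ioo, mem_univ, and_true, mem_iUnion]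
      constructor
      · rintro ⟨ht0, htT⟩
        obtain ⟨n, hn⟩ := exists_nat_gt (T / t)
        refine ⟨n, ?_, htT⟩
        have h1 : T < (n : ℝ) * t := (div_lt_iff₀ ht0).1 hn
        rw [div_lt_iff₀ (by positivity)]
        nlinarith
      · rintro ⟨n, h1, h2⟩
        exact ⟨lt_trans (by positivity) h1, h2⟩
    rw [hU, ae_restrict_iUnion_iff]
    exact hn
  intro T₄ hT₄
  have hI₄ : Ioo T₄ T ⊆ Ioo 0 T := Ioo_subset_Ioo hT₄.1.le le_rfl
  obtain ⟨Rf, Uf, hUf1, hUfv, hcurl⟩ :=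
    localLeray_farField_curl_eq_zero_slab_of_halfSpace_irrotational
      NSBoundedHigherRegularityBounds_holds one_pos hdiv hv hirr hT₄
  obtain ⟨Rb, hRb⟩ :=
    hv.farField_bound_anyDatum one_pos hT₄.1 (le_refl T)
  have hfar := ae_norm_le_toReal_of_eLpNorm_top_lt_top hRb
  have hreg : ∀ᵐ t ∂(volume.restrict (Ioo T₄ T)), ∀ x : EuclideanSpace ℝ (Fin 3),
      IsRegularPoint v (t, x) :=
    ae_restrict_of_ae_restrict_of_subset hI₄ (ae_forall_isRegularPoint_slab one_pos hv.suitable)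
  have hstrip : ∀ᵐ t ∂(volume.restrict (Ioo T₄ T)), ∃ q : ℚ × ℚ, t ∈ Ioo (q.1 : ℝ) q.2 ∧
      ∀ᵐ z ∂(volume.restrict (Ioo (q.1 : ℝ) q.2 ×ˢ (univ : Set (EuclideanSpace ℝ (Fin 3))))),
        v z.1 z.2 = 0 := by
    filter_upwards [hreg, ae_restrict_mem measurableSet_Ioo] with t ht htI
    obtain ⟨τ, hτ, hsubτ, L, hL⟩ := exists_strip_bound_Ioo hfar (fun x _ => ht x) htI
    obtain ⟨h1, h2⟩ := (Ioo_subset_Ioo_iff (by linarith : t - τ < t + τ)).1 hsubτ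
    have ha : 0 < t - τ := lt_of_lt_of_le hT₄.1 h1
    have hab : t - τ < t + τ / 2 := by linarith
    have hbT : t + τ / 2 ≤ T := by linarith
    have hJ : Ioo (t - τ) (t + τ / 2) ⊆ Ioo T₄ T := Ioo_subset_Ioo h1 (by linarith)
    have hbd : ∀ᵐ z ∂(volume.restrict
        (Ioo (t - τ) (t + τ / 2) ×ˢ (univ : Set (EuclideanSpace ℝ (Fin 3))))), ‖v z.1 z.2‖ ≤ L :=
      ae_restrict_of_ae_restrict_of_subset
        (prod_mono (Ioo_subset_Ioo le_rfl (by linarith)) Subset.rfl) hL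
    have hz := ae_zero_strip_of_farField_curl_eq_zero NSBoundedHigherRegularityBounds_holds
      kangMiuraTsai_local_pressure_bound_holds hdiv hv ha hab hbT hbd
      (fun s hs => hUf1 s (hJ hs))
      (ae_restrict_of_ae_restrict_of_subset (prod_mono hJ Subset.rfl) hUfv)
      (fun s hs x hx => hcurl s (hJ hs) x hx)
    obtain ⟨q₁, hq₁a, hq₁t⟩ := exists_rat_btwn (show t - τ / 4 < t by linarith)
    obtain ⟨q₂, hq₂t, hq₂b⟩ := exists_rat_btwn (show t < t + τ / 2 by linarith)
    refine ⟨(q₁, q₂), ⟨hq₁t, hq₂t⟩, ae_restrict_of_ae_restrict_of_subset (prod_mono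
      (Ioo_subset_Ioo (by linarith) hq₂b.le) Subset.rfl) hz⟩
  set G : Set (ℚ × ℚ) := {q | ∀ᵐ z ∂(volume.restrict
    (Ioo (q.1 : ℝ) q.2 ×ˢ (univ : Set (EuclideanSpace ℝ (Fin 3))))), v z.1 z.2 = 0} with hG
  set S : Set ℝ := ⋃ q ∈ G, Ioo (q.1 : ℝ) q.2 with hSdef
  have hS : ∀ᵐ z ∂(volume.restrict (S ×ˢ (univ : Set (EuclideanSpace ℝ (Fin 3))))),
      v z.1 z.2 = 0 := by
    have e : S ×ˢ (univ : Set (EuclideanSpace ℝ (Fin 3))) =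
        ⋃ q ∈ G, Ioo (q.1 : ℝ) q.2 ×ˢ (univ : Set (EuclideanSpace ℝ (Fin 3))) := by
      rw [hSdef]
      simp only [iUnion_prod_const]
    rw [e, ae_restrict_biUnion_iff _ (Set.to_countable G)]
    exact fun q hq => hq
  have hnull : volume (Ioo T₄ T \ S) = 0 := by
    refine measure_eq_zero_iff_ae_notMem.2 ?_
    have h := (ae_restrict_iff' measurableSet_Ioo).1 hstrip
    filter_upwards [h] with t ht hmem
    obtain ⟨q, hq, hqG⟩ := ht hmem.1
    exact hmem.2 (mem_iUnion₂.2 ⟨q, hqG, hq⟩)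
  have hcover : Ioo T₄ T ×ˢ (univ : Set (EuclideanSpace ℝ (Fin 3))) ⊆
      S ×ˢ (univ : Set (EuclideanSpace ℝ (Fin 3))) ∪
        (Ioo T₄ T \ S) ×ˢ (univ : Set (EuclideanSpace ℝ (Fin 3))) := by
    rintro ⟨t, x⟩ ⟨ht, -⟩
    by_cases hts : t ∈ S
    · exact Or.inl ⟨hts, mem_univ _⟩
    · exact Or.inr ⟨⟨ht, hts⟩, mem_univ _⟩
  refine ae_restrict_of_ae_restrict_of_subset hcover ?_
  rw [ae_restrict_union_iff]
  refine ⟨hS, ?_⟩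
  have h0 : volume ((Ioo T₄ T \ S) ×ˢ (univ : Set (EuclideanSpace ℝ (Fin 3)))) = 0 := by
    rw [Measure.volume_eq_prod, Measure.prod_prod, hnull, zero_mul]
  rw [Measure.restrict_eq_zero.2 h0, ae_zero]
  exact eventually_bot

end Literature.Analysis.FluidPDE

end
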